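import Mathlib.FieldTheory.IntermediateField.Algebraic
import Mathlib.RingTheory.Algebraic.Basic
import Mathlib.LinearAlgebra.FiniteDimensional.Lemmas
import HarnessLib

/-!
# The values of an algebra homomorphism on a finite-dimensional algebra lie in a finite extension

Topic `FieldTheory/AlgClosed` (used with `L = ℂ`, `K = ℚ`); theorems only. The algebraic step of
"the Hecke eigenvalues of an eigenclass in a cohomology group with a `ℚ`-structure generate a
number field" (Clozel 1990, proof of Thm. 3.13 (i), §3.5; Shimura 1971, Thm. 3.48): if `𝕋` is a
finite-dimensional `K`-algebra (e.g. the `ℚ`-algebra generated by commuting Hecke operators on a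
finite-dimensional `ℚ`-vector space) and `χ : 𝕋 →ₐ[K] L` an eigencharacter with values in a field
`L ⊇ K`, then all values `χ t` lie in ONE intermediate field `E` finite over `K` — the range of
`χ`, a finite-dimensional `K`-subalgebra of `L`, is a field.

* `AlgHom.exists_intermediateField_finiteDimensional_forall_mem` — the statement above.

## References

* L. Clozel, *Motifs et formes automorphes* (1990), §3.1 and proof of Thm. 3.13. [Clozel1990]
* G. Shimura, *Introduction to the arithmetic theory of automorphic functions* (1971), Thm. 3.48.
-/

namespace Literature.FieldTheory.AlgClosed

/-- **The values of an algebra homomorphism on a finite-dimensional `K`-algebra lie in a finite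
extension of `K`.** For a field extension `L / K`, a `K`-algebra `𝕋` finite-dimensional over `K`
and `χ : 𝕋 →ₐ[K] L`, there is an intermediate field `E`, finite-dimensional over `K`, containing
every `χ t`: the range of `χ` is a finite-dimensional subalgebra of `L`, all of whose elements are
algebraic over `K`, hence closed under inverses (`Subalgebra.inv_mem_of_algebraic`). With `K = ℚ`,
`L = ℂ`: the eigenvalues of a simultaneous eigenvector of a commuting family of operators
preserving a finite-dimensional `ℚ`-structure generate a number field (Clozel 1990, proof of
Thm. 3.13 (i)). [cite: Clozel1990, §3.5 (proof of Thm. 3.13 (i))] -/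
theorem AlgHom.exists_intermediateField_finiteDimensional_forall_mem {K L 𝕋 : Type*} [Field K]
    [Field L] [Algebra K L] [Ring 𝕋] [Algebra K 𝕋] [Module.Finite K 𝕋] (χ : 𝕋 →ₐ[K] L) :
    ∃ E : IntermediateField K L, FiniteDimensional K E ∧ ∀ t : 𝕋, χ t ∈ E := by
  classical
  let S : Subalgebra K L := χ.range
  -- the range is finite-dimensional over `K`
  haveI : Module.Finite K S := by
    have h : (Subalgebra.toSubmodule S) = LinearMap.range χ.toLinearMap := by
      ext x
      simp only [Subalgebra.mem_toSubmodule, AlgHom.mem_range, LinearMap.mem_range,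
        AlgHom.toLinearMap_apply, S]
    have hfin : Module.Finite K (LinearMap.range χ.toLinearMap) := inferInstance
    have e : (Subalgebra.toSubmodule S) ≃ₗ[K] LinearMap.range χ.toLinearMap :=
      LinearEquiv.ofEq _ _ h
    exact Module.Finite.equiv e.symm
  -- hence algebraic over `K`, hence closed under inverses
  haveI : Algebra.IsAlgebraic K S := Algebra.IsAlgebraic.of_finite K S
  have hinv : ∀ x ∈ S, x⁻¹ ∈ S := by
    intro x hx
    have halg : IsAlgebraic K (x : L) := by
      have h : IsAlgebraic K (⟨x, hx⟩ : S) := Algebra.IsAlgebraic.isAlgebraic _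
      exact (isAlgebraic_algHom_iff S.val Subtype.val_injective).mpr h
    exact S.inv_mem_of_algebraic (x := ⟨x, hx⟩) halg
  refine ⟨S.toIntermediateField hinv, ?_, fun t ↦ ⟨t, rfl⟩⟩
  change FiniteDimensional K S
  infer_instance

end Literature.FieldTheory.AlgClosed
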